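import Mathlib
import HarnessLib
import Literature.Probability.RandomPlanarGeometry.HexParafermion
import Literature.Probability.RandomPlanarGeometry.HexSAW
import Literature.Probability.RandomPlanarGeometry.ConformalMap
import Literature.Probability.RandomPlanarGeometry.SLE

/-!
# Sketch — crux HexConjecture (stmt-CriticalPhenomena-0808), idea `root-locality-replaces-loewner`

First lemmas of the line, stated over existing declarations (no proofs).
-/

namespace Summit.CriticalPhenomena.SAWScalingLimit.Cruxes.HexConjecture.RootLocality

open scoped BigOperators Topology
open Filter Set MeasureTheory
open Literature.Probability.RandomPlanarGeometry Literature.Probability.RandomPlanarGeometry.SAW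
open Literature.Probability.LatticeModels

/-- **RootDominance** (root locality of the boundary-rooted parafermionic observable, complex form).
Setting: a Dobrushin domain `D`, two admissible hexagonal discretisation families `Λ' δ ⊆ Λ δ`
(simply connected, inside `Ω`, same boundary root `a δ → a = D.pt 0`) which AGREE inside the ball
`B(a, ρ)` and exhaust the compacts of `Ω ∩ B(a, ρ)`; `F, F'` the two observables at `x_c`, `σ = 5/8`.
Claim: for every `ε > 0` there are `r > 0` and a nonnegative continuous bump `ψ ≢ 0` supported in
`Ω ∩ B(a, r)` such that eventually `‖Σ_e ψ(δe) F'(e) − Σ_e ψ(δe) F(e)‖ ≤ ε ‖Σ_e ψ(δe) F(e)‖`: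
the `ψ`-average of the observable near its root does not feel a far-away change of the domain.
Given `HexObservableLimit` (stmt-5420) in `Ω` and `Ω'`, this is EQUIVALENT to the avoidance-cocycle
limit `Z_{Λ'}(a,b)/Z_Λ(a,b) → Φ_A'(0)^{5/8}` (LSW restriction value). -/
def RootDominance : Prop :=
  ∀ (D : DobrushinDomain) (ρ : ℝ) (Λ Λ' : ℝ → Finset HexVertex) (a : ℝ → Sym2 HexVertex),
    let F : ℝ → Sym2 HexVertex → ℂ := fun δ z =>
      hexParafermionicObservable (Λ δ) (a δ) hexCriticalFugacity (5 / 8) z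
    let F' : ℝ → Sym2 HexVertex → ℂ := fun δ z =>
      hexParafermionicObservable (Λ' δ) (a δ) hexCriticalFugacity (5 / 8) z
    0 < ρ →
    (∀ᶠ δ : ℝ in 𝓝[>] 0,
      hexDomainSimplyConnected (Λ δ) ∧ hexDomainSimplyConnected (Λ' δ) ∧ Λ' δ ⊆ Λ δ ∧
      a δ ∈ hexDomainBoundary (Λ δ) ∧ a δ ∈ hexDomainBoundary (Λ' δ) ∧
      (∀ v ∈ Λ δ, (δ : ℂ) * hexCenter v ∈ D.carrier) ∧
      (∀ v : HexVertex, (δ : ℂ) * hexCenter v ∈ Metric.ball (D.pt 0) ρ → (v ∈ Λ' δ ↔ v ∈ Λ δ))) →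
    (∀ K : Set ℂ, IsCompact K → K ⊆ D.carrier ∩ Metric.ball (D.pt 0) ρ →
      ∀ᶠ δ : ℝ in 𝓝[>] 0, ∀ v : HexVertex, (δ : ℂ) * hexCenter v ∈ K → v ∈ Λ δ) →
    Tendsto (fun δ : ℝ => (δ : ℂ) * hexMidpoint (a δ)) (𝓝[>] 0) (𝓝 (D.pt 0)) →
    ∀ ε : ℝ, 0 < ε → ∃ r : ℝ, 0 < r ∧ ∃ ψ : ℂ → ℝ, Continuous ψ ∧ HasCompactSupport ψ ∧
      (∀ z, 0 ≤ ψ z) ∧ (∃ z, ψ z ≠ 0) ∧ tsupport ψ ⊆ D.carrier ∩ Metric.ball (D.pt 0) r ∧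
      ∀ᶠ δ : ℝ in 𝓝[>] 0,
        ‖(∑ᶠ e ∈ hexDomainMidEdges (Λ' δ), (ψ ((δ : ℂ) * hexMidpoint e) : ℂ) * F' δ e) -
            ∑ᶠ e ∈ hexDomainMidEdges (Λ δ), (ψ ((δ : ℂ) * hexMidpoint e) : ℂ) * F δ e‖ ≤
          ε * ‖∑ᶠ e ∈ hexDomainMidEdges (Λ δ), (ψ ((δ : ℂ) * hexMidpoint e) : ℂ) * F δ e‖

/-- **BoundaryRootDominance** (positive, mesoscopic form): in the setting of `RootDominance`, for
boundary mid-edges `z` of BOTH domains within macroscopic distance `δ^α` of the root (some fixed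
`α ∈ (0,1)`), the fraction of the `x_c`-mass of walks `a → z` that is lost when passing from `Λ δ` to
the smaller `Λ' δ` tends to `0` uniformly. All quantities are POSITIVE partition functions
(`σ = 0`), so sum-rule / bridge-decay (Krachun–Panagiotis 2023) methods apply. -/
def BoundaryRootDominance : Prop :=
  ∀ (D : DobrushinDomain) (ρ : ℝ) (Λ Λ' : ℝ → Finset HexVertex) (a : ℝ → Sym2 HexVertex),
    let Z : ℝ → Sym2 HexVertex → ℂ := fun δ z =>
      hexParafermionicObservable (Λ δ) (a δ) hexCriticalFugacity 0 z
    let Z' : ℝ → Sym2 HexVertex → ℂ := fun δ z =>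
      hexParafermionicObservable (Λ' δ) (a δ) hexCriticalFugacity 0 z
    0 < ρ →
    (∀ᶠ δ : ℝ in 𝓝[>] 0,
      hexDomainSimplyConnected (Λ δ) ∧ hexDomainSimplyConnected (Λ' δ) ∧ Λ' δ ⊆ Λ δ ∧
      a δ ∈ hexDomainBoundary (Λ δ) ∧ a δ ∈ hexDomainBoundary (Λ' δ) ∧
      (∀ v ∈ Λ δ, (δ : ℂ) * hexCenter v ∈ D.carrier) ∧
      (∀ v : HexVertex, (δ : ℂ) * hexCenter v ∈ Metric.ball (D.pt 0) ρ → (v ∈ Λ' δ ↔ v ∈ Λ δ))) →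
    Tendsto (fun δ : ℝ => (δ : ℂ) * hexMidpoint (a δ)) (𝓝[>] 0) (𝓝 (D.pt 0)) →
    ∃ α : ℝ, 0 < α ∧ α < 1 ∧ ∀ ε : ℝ, 0 < ε → ∀ᶠ δ : ℝ in 𝓝[>] 0,
      ∀ z ∈ hexDomainBoundary (Λ δ) ∩ hexDomainBoundary (Λ' δ),
        dist ((δ : ℂ) * hexMidpoint z) (D.pt 0) ≤ δ ^ α →
          ‖Z δ z‖ - ‖Z' δ z‖ ≤ ε * ‖Z δ z‖

/-- **HexAvoidanceCocycle** (the restriction formula for the critical hexagonal SAW, with its VALUE):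
for Dobrushin domains `D' ⊆ D` with the same marked points and agreeing near them, and every
hexagonal endpoint approximation of `D`, the probability that the critical hexagonal SAW of `D`
stays in `closure D'` converges to `(Φ_A'(0))^{5/8}`, written through chordal uniformisers
`Ψ : D → ℍ`, `Ψ' : D' → ℍ` (`a ↦ ∞`, `b ↦ 0`) as the ratio of the two boundary dilation factors of
`Ψ ∘ Ψ'⁻¹` at `∞` and at `0` (scale-free). This is the hypothesis H1/PFR of the hyperspace card with
the LSW value; the line derives it from `HexObservableLimit` + `RootDominance`. -/
def HexAvoidanceCocycle : Prop :=
  ∀ (D D' : DobrushinDomain) (a b : ℝ → HexVertex)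
    (Ψ : ConformalEquiv D.carrier UpperHalfPlane.upperHalfPlaneSet)
    (Ψ' : ConformalEquiv D'.carrier UpperHalfPlane.upperHalfPlaneSet) (L0 Linf : ℂ),
    IsEmbEndpointApprox hexGraph hexCenter D a b →
    D'.carrier ⊆ D.carrier → D'.pt 0 = D.pt 0 → D'.pt 1 = D.pt 1 →
    (∃ ε : ℝ, 0 < ε ∧ D'.carrier ∩ Metric.ball (D.pt 0) ε = D.carrier ∩ Metric.ball (D.pt 0) ε ∧
      D'.carrier ∩ Metric.ball (D.pt 1) ε = D.carrier ∩ Metric.ball (D.pt 1) ε) →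
    Tendsto (fun x => ‖Ψ x‖) (𝓝[D.carrier] (D.pt 0)) atTop → Ψ.HasBoundaryValue (D.pt 1) 0 →
    Tendsto (fun x => ‖Ψ' x‖) (𝓝[D'.carrier] (D.pt 0)) atTop → Ψ'.HasBoundaryValue (D.pt 1) 0 →
    Tendsto (fun w : ℂ => Ψ (Ψ'.symm w) / w) (𝓝[UpperHalfPlane.upperHalfPlaneSet] 0) (𝓝 L0) →
    Tendsto (fun w : ℂ => Ψ (Ψ'.symm w) / w)
      (Filter.cocompact ℂ ⊓ 𝓟 UpperHalfPlane.upperHalfPlaneSet) (𝓝 Linf) →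
    Tendsto (fun δ : ℝ =>
        ((hexSAWLaw D.carrier δ (a δ) (b δ)).map
            (fun γ : HexDomainSAW D.carrier δ (a δ) (b δ) => γ.curve))
          (CurveClass.rangeSubset (closure D'.carrier)))
      (𝓝[>] 0) (𝓝 (ENNReal.ofReal ((‖Linf‖ / ‖L0‖) ^ ((5 : ℝ) / 8))))

end Summit.CriticalPhenomena.SAWScalingLimit.Cruxes.HexConjecture.RootLocality
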